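import Literature.AlgebraicGeometry.Resolution.BlowupDisjointCentreSplitting
import Literature.AlgebraicGeometry.Resolution.MonomialOrderReductionUnit
import HarnessLib

/-!
# [OURS · L1 W4.5(b)] BLOW-UPS ALONG A PRODUCT OF CENTRES ARE REGULAR WHERE THE BLOW-UPS ALONG THE FACTORS ARE
# (crux `Theses.EquisingularLift.EquisingularLiftNat`, stmt-ResolutionOfSingularities-20038)

NOT a statement of any manuscript; OURS kernel plumbing (cell `res-hironaka`, chain w45b; seat res-D-pv-013, own initiative, counted 0). AI-written,
weaker than expert review. No definition, no `sorry`, standard axioms.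

Input of the MULTI-POINT rung of the any-`n` EL♮ supplier programme (several ordinary multiple points resolved by ONE step along the product of
the point centres). Everything for an arbitrary scheme `X` and ideal sheaves `I, J` (resp. a list `L`) on it:

* **`IsBlowup.isRegularLocalRing_stalk_of_mul`** — if every blow-up of `X` along `I` has regular local rings at all points over `A ⊆ X`, and
  every blow-up along `J` at all points over `B`, then every blow-up `τ : X' → X` along `I · J` has regular local rings at all points over
  `(A ∖ supp J) ∪ (B ∖ supp I)`: split `τ = τ₂ ≫ τ₁` (Stacks 080A read backwards, tree `IsBlowup.exists_comp_eq_of_mul`), `τ₁` a blow-up along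
  `I` (resp. `J`), `τ₂` a blow-up along `J𝒪` (resp. `I𝒪`) — an isomorphism on stalks off the pulled-back support (Stacks 02OS, tree
  `IsBlowup.isIso_stalkMap_of_not_mem_support`). No disjointness is needed here.
* **`IsBlowup.isRegularLocalRing_stalk_of_prod`** — for a list `L` of ideal sheaves with PAIRWISE DISJOINT supports such that, for each `I ∈ L`,
  every blow-up along `I` is regular at all points over `supp I ∪ Reg(X)`, every blow-up along `Π L` is regular at all points over
  `supp (Π L) ∪ Reg(X)` (`Reg(X)` = the points with regular local ring); **`IsBlowup.isRegular_of_prod`** — hence regular outright when `X` is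
  regular off `supp (Π L)`.

References: The Stacks Project, Tags 080A, 02OS — through the cited tree files (`BlowupDisjointCentreSplitting`, `MonomialOrderReductionUnit`).
-/

set_option linter.dupNamespace false -- mandated namespace `Summit.<Summit>.<Problem>` of this single-conjunct summit

noncomputable section

open CategoryTheory AlgebraicGeometry TopologicalSpace
open Literature.AlgebraicGeometry.Resolution

universe u

namespace Summit.ResolutionOfSingularities.ResolutionOfSingularities.Cruxes.EquisingularLiftNat.Sections

namespace MultiCentre

variable {X : Scheme.{u}}

/-- **One factor**: if every blow-up of `X` along `I` is regular at all points over `A`, then every blow-up `τ` along `I · J` is regular at all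
points over `A ∖ supp J` — split `τ = τ₂ ≫ τ₁` with `τ₁` a blow-up along `I` and `τ₂` a blow-up along `J𝒪_{X₁}`, which is an isomorphism on
stalks off `τ₁⁻¹(supp J)`. [cite: StacksProject, Tag 080A] [cite: StacksProject, Tag 02OS] -/
theorem isRegularLocalRing_stalk_of_mul_left {I J : X.IdealSheafData} (A : Set X)
    (hI : ∀ (X₁ : Scheme.{u}) (τ₁ : X₁ ⟶ X), IsBlowup τ₁ I → ∀ z : X₁, τ₁ z ∈ A →
      IsRegularLocalRing (X₁.presheaf.stalk z))
    {X' : Scheme.{u}} {τ : X' ⟶ X} (hτ : IsBlowup τ (I * J)) (z : X') (hzA : τ z ∈ A)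
    (hzJ : τ z ∉ (J.support : Set X)) : IsRegularLocalRing (X'.presheaf.stalk z) := by
  obtain ⟨X₁, τ₁, τ₂, hτ₁, hτ₂, hfac⟩ := hτ.exists_comp_eq_of_mul
  have hz₁ : τ₁ (τ₂ z) = τ z := by
    rw [← Scheme.Hom.comp_apply, hfac]
  have hreg : IsRegularLocalRing (X₁.presheaf.stalk (τ₂ z)) := hI X₁ τ₁ hτ₁ (τ₂ z) (by rw [hz₁]; exact hzA)
  have hns : τ₂ z ∉ (J.comap τ₁).support := by
    intro h
    apply hzJ
    have h' : τ₂ z ∈ ((J.comap τ₁).support : Set X₁) := h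
    rw [Scheme.IdealSheafData.support_comap] at h'
    change τ₁ (τ₂ z) ∈ (J.support : Set X) at h'
    rwa [hz₁] at h'
  haveI := hτ₂.isIso_stalkMap_of_not_mem_support hns
  haveI := hreg
  exact IsRegularLocalRing.of_ringEquiv (R := X₁.presheaf.stalk (τ₂ z)) (asIso (τ₂.stalkMap z)).commRingCatIsoToRingEquiv

/-- **BLOW-UPS ALONG `I · J` ARE REGULAR WHERE THE BLOW-UPS ALONG `I` AND ALONG `J` ARE**: if every blow-up along `I` is regular at all points
over `A` and every blow-up along `J` at all points over `B`, then every blow-up along `I · J` is regular at all points over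
`(A ∖ supp J) ∪ (B ∖ supp I)` (split either way round, `I · J = J · I`). [cite: StacksProject, Tag 080A] [cite: StacksProject, Tag 02OS] -/
theorem isRegularLocalRing_stalk_of_mul {I J : X.IdealSheafData} (A B : Set X)
    (hI : ∀ (X₁ : Scheme.{u}) (τ₁ : X₁ ⟶ X), IsBlowup τ₁ I → ∀ z : X₁, τ₁ z ∈ A →
      IsRegularLocalRing (X₁.presheaf.stalk z))
    (hJ : ∀ (X₁ : Scheme.{u}) (τ₁ : X₁ ⟶ X), IsBlowup τ₁ J → ∀ z : X₁, τ₁ z ∈ B →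
      IsRegularLocalRing (X₁.presheaf.stalk z))
    {X' : Scheme.{u}} {τ : X' ⟶ X} (hτ : IsBlowup τ (I * J)) (z : X')
    (hz : τ z ∈ (A \ (J.support : Set X)) ∪ (B \ (I.support : Set X))) :
    IsRegularLocalRing (X'.presheaf.stalk z) := by
  rcases hz with ⟨hzA, hzJ⟩ | ⟨hzB, hzI⟩
  · exact isRegularLocalRing_stalk_of_mul_left A hI hτ z hzA hzJ
  · rw [mul_comm] at hτ
    exact isRegularLocalRing_stalk_of_mul_left B hJ hτ z hzB hzI

/-- A blow-up along the unit ideal sheaf is an isomorphism, so its source has regular local rings over the regular points of `X`.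
[cite: StacksProject, Tag 02OS] -/
theorem isRegularLocalRing_stalk_of_top {X' : Scheme.{u}} {τ : X' ⟶ X} (hτ : IsBlowup τ (⊤ : X.IdealSheafData)) (z : X')
    (hz : IsRegularLocalRing (X.presheaf.stalk (τ z))) : IsRegularLocalRing (X'.presheaf.stalk z) := by
  haveI : IsIso τ := hτ.isIso isEffectiveCartier_top
  haveI := hz
  exact IsRegularLocalRing.of_ringEquiv (R := X.presheaf.stalk (τ z)) (asIso (τ.stalkMap z)).commRingCatIsoToRingEquiv

/-- **BLOW-UPS ALONG A PRODUCT OF CENTRES WITH PAIRWISE DISJOINT SUPPORTS**: if for each `I ∈ L` every blow-up of `X` along `I` is regular at all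
points over `supp I ∪ Reg(X)`, then every blow-up along `Π L` is regular at all points over `supp (Π L) ∪ Reg(X)` (induction on `L` through
`isRegularLocalRing_stalk_of_mul`; a point of `supp I` lies in no other support). [cite: StacksProject, Tag 080A] [cite: StacksProject, Tag 02OS] -/
theorem isRegularLocalRing_stalk_of_prod (L : List X.IdealSheafData)
    (hL : L.Pairwise fun I J : X.IdealSheafData => Disjoint (I.support : Set X) J.support)
    (h : ∀ I ∈ L, ∀ (X₁ : Scheme.{u}) (τ₁ : X₁ ⟶ X), IsBlowup τ₁ I → ∀ z : X₁,
      τ₁ z ∈ (I.support : Set X) ∪ {x | IsRegularLocalRing (X.presheaf.stalk x)} →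
      IsRegularLocalRing (X₁.presheaf.stalk z))
    {X' : Scheme.{u}} {τ : X' ⟶ X} (hτ : IsBlowup τ L.prod) (z : X')
    (hz : τ z ∈ (L.prod.support : Set X) ∪ {x | IsRegularLocalRing (X.presheaf.stalk x)}) :
    IsRegularLocalRing (X'.presheaf.stalk z) := by
  induction L generalizing X' with
  | nil =>
    rw [List.prod_nil, Scheme.IdealSheafData.one_eq_top] at hτ hz
    rw [Scheme.IdealSheafData.support_top] at hz
    rcases hz with hz | hz
    · exact absurd hz (Set.notMem_empty _)
    · exact isRegularLocalRing_stalk_of_top hτ z hz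
  | cons I L ih =>
    rw [List.pairwise_cons] at hL
    rw [List.prod_cons] at hτ hz
    refine isRegularLocalRing_stalk_of_mul ((I.support : Set X) ∪ {x | IsRegularLocalRing (X.presheaf.stalk x)})
      ((L.prod.support : Set X) ∪ {x | IsRegularLocalRing (X.presheaf.stalk x)})
      (h I (List.mem_cons_self ..)) (fun X₁ τ₁ hτ₁ w hw => ih hL.2 (fun J hJ => h J (List.mem_cons_of_mem _ hJ)) hτ₁ w hw) hτ z ?_
    -- `supp (I · Π L) ∪ Reg ⊆ (supp I ∪ Reg) ∖ supp Π L ∪ (supp Π L ∪ Reg) ∖ supp I`, by disjointness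
    have hdisj : Disjoint (I.support : Set X) (L.prod.support : Set X) := by
      rw [IdealSheafData.coe_support_prod, Set.disjoint_iUnion₂_right]
      exact fun J hJ => hL.1 J hJ
    by_cases hzL : τ z ∈ (L.prod.support : Set X)
    · right
      exact ⟨Or.inl hzL, fun hzI => hdisj.le_bot ⟨hzI, hzL⟩⟩
    · left
      refine ⟨?_, hzL⟩
      rw [Scheme.IdealSheafData.support_mul, Closeds.coe_sup] at hz
      rcases hz with (hzI | hzL') | hzR
      · exact Or.inl hzI
      · exact absurd hzL' hzL
      · exact Or.inr hzR

/-- **Hence regular outright** when `X` is regular off `supp (Π L)`. [cite: StacksProject, Tag 080A] -/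
theorem isRegular_of_prod (L : List X.IdealSheafData)
    (hL : L.Pairwise fun I J : X.IdealSheafData => Disjoint (I.support : Set X) J.support)
    (h : ∀ I ∈ L, ∀ (X₁ : Scheme.{u}) (τ₁ : X₁ ⟶ X), IsBlowup τ₁ I → ∀ z : X₁,
      τ₁ z ∈ (I.support : Set X) ∪ {x | IsRegularLocalRing (X.presheaf.stalk x)} →
      IsRegularLocalRing (X₁.presheaf.stalk z))
    (hoff : ∀ x : X, x ∉ (L.prod.support : Set X) → IsRegularLocalRing (X.presheaf.stalk x))
    {X' : Scheme.{u}} {τ : X' ⟶ X} (hτ : IsBlowup τ L.prod) : Scheme.IsRegular X' := by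
  intro z
  refine isRegularLocalRing_stalk_of_prod L hL h hτ z ?_
  by_cases hz : τ z ∈ (L.prod.support : Set X)
  · exact Or.inl hz
  · exact Or.inr (hoff _ hz)

end MultiCentre

end Summit.ResolutionOfSingularities.ResolutionOfSingularities.Cruxes.EquisingularLiftNat.Sections

end
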